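import Mathlib
import HarnessLib
import Summits.FinalStateConjecture.FinalStateConjecture.Theses.PhaseMixingCapture
import Literature.Geometry.Lorentzian.KerrData

/-!
# Sketch — first lemmas for the crux-ideate cards on `PhaseMixingCapture.BulkKerrCapture`
(planner-cruxidea-stmt-FinalStateConjecture-10696-2-0, round 1, ideator 2)

The crux (`BulkKerrCapture`, stmt-FinalStateConjecture-10696) is FIXED; nothing here restates or weakens it.
What is proved here is glue and the analytic cores of the two levers:

* `Capture` — the crux's conclusion at one spin `a` (everything after `∀ a, |a| ≤ a₁ M →`), so that
  `BulkKerrCapture ↔ ∀ a₁ < 1, ∃ (s δ k), ∀ M > 0, ∃ ε > 0, ∃ C, ∀ a, |a| ≤ a₁ M → Capture …` is `Iff.rfl`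
  (`bulkKerrCapture_iff`); `Capture.mono` (antitone in `ε`, monotone in `C`); `CaptureLip` (Lipschitz
  modulus `C · dist`) and `Capture.of_lip` (Lipschitz ⇒ the crux's `C · √dist` once `ε ≤ 1`).
* CARD 1 (`modulus-rides-the-nash-moser-unknown`), first lemma `bulk_of_locallyUniform`:
  `LocallyUniformCapture → BulkKerrCapture` — a pointwise theorem whose constants are uniform on a spin-RATIO
  neighbourhood of each `α₀ = a/M ∈ [−a₁, a₁]` (the shape Hintz arXiv:2606.28253 Thm 13.1 + Remark 13.2 print,
  up to the modulus) gives the crux by a finite-subcover argument on `[−a₁, a₁]` (sorry-free).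
* CARD 2 (`secant-linearisation-modulus`), first lemmas: `secant_modulus` — if the nonlinear solution `U`
  (whose first components ARE the final parameters `b − b₀`) satisfies `Φ U = 0`, the reference linearisation `A`
  obeys the linear-stability (left-inverse) estimate `c‖v‖ ≤ ‖A v‖` and `Φ` is `q`-approximately linear on the
  basin with `q < c`, then `‖U‖ ≤ (c − q)⁻¹ ‖Φ 0‖` (sorry-free); and `uniform_qualitative_modulus` — the
  Dini/finite-subcover lemma turning a POINTWISE modulus `φ b r → 0 (r → 0)` plus the recentring inequality
  `φ b' r ≤ φ b (r + L|b' − b|) + |b' − b|` into a modulus uniform on compact parameter sets (sorry-free): all of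
  the crux's uniformity except the RATE is soft.
* CARD 3 (`charges-pin-the-final-state`), first lemma `modulus_of_charge_balance` (+ `modulus_of_quadratic_flux`):
  charge balance `M_f = M − E`, `a_f M_f = aM − J` with fluxes `E, |J|` controls `|M_f − M| + |a_f − a|` by the fluxes alone;
  quadratic fluxes give a quadratic (a fortiori `√`) modulus (sorry-free).
* `far_subset_slice` — recentring infrastructure: every slice `Kerr.slice a M`, `|a| ≤ a₁ M`, contains the
  fixed far region `{‖y‖ > M √(1 + a₁²) + 1}` (sorry-free).
-/

open scoped Manifold ContDiff Topology ENNReal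
open Set Filter Literature.Geometry.Lorentzian

noncomputable section

namespace Summit.FinalStateConjecture.FinalStateConjecture.Cruxes.BulkKerrCapture.SketchIdeator2

open Summit.FinalStateConjecture.FinalStateConjecture.Theses.PhaseMixingCapture

/-! ### The crux's conclusion at one spin, and its bookkeeping -/

/-- The conclusion of `BulkKerrCapture` at mass `M`, spin `a`, exponents `(s, δ, k)` and constants `(ε, C)`:
verbatim the text of the crux after `∀ a : ℝ, |a| ≤ a₁ * M →`. -/
def Capture [Kerr.Facts] [Kerr.SliceFacts] (s : ℕ) (δ : ℝ) (k : ℕ) (M : ℝ) (hM : 0 < M) (ε C a : ℝ) :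
    Prop :=
  ∀ (D : InitialDataSet 𝓘(ℝ, E3) (Kerr.slice a M)) [D.metric.HasLeviCivita],
    D.IsVacuumConstraintSolution →
    InitialDataSet.dataWeightedSobolevEDist s δ D (Kerr.data M a M hM.le) < ENNReal.ofReal ε →
    ∀ 𝒟 : VacuumCauchyDevelopment D, 𝒟.IsMaximal →
      ∃ (M' a' : ℝ) (𝒟oc : Set 𝒟.carrier), Kerr.IsSubextremal M' a' ∧
        (∀ [𝒟.metric.HasLeviCivita], ∃ B₀ : Set (Kerr.slice a M), IsCompact B₀ ∧ ∀ σ : ℝ, 0 < σ →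
          ∃ B₁ : Set (Kerr.slice a M), IsCompact B₁ ∧
            ∀ q ∈ {q : Kerr.slice a M | Kerr.afRadius a M + 1 ≤ ‖(q : E3)‖}, q ∉ B₁ →
              ∀ (ray : ℝ → 𝒟.carrier) (dom : Set ℝ),
                𝒟.metric.IsNormalisedNullRayFrom 𝒟.timeOrientation 𝒟.embed 𝒟.normal q ray dom →
                ¬ BddAbove dom ∨ ENNReal.ofReal σ ≤
                  sojournTime ray dom (𝒟.metric.causalFuture 𝒟.timeOrientation (𝒟.embed '' B₀))) ∧
        𝒟.toSpacetime.ConvergesToKerr 𝒟oc M' a' k ∧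
        |M' - M| + |a' - a| ≤
          C * √(InitialDataSet.dataWeightedSobolevEDist s δ D (Kerr.data M a M hM.le)).toReal

/-- The crux, refactored through `Capture` — by `Iff.rfl` (nothing is restated). -/
theorem bulkKerrCapture_iff :
    BulkKerrCapture ↔
      ∀ [Kerr.Facts] [Kerr.SliceFacts], ∀ a₁ : ℝ, a₁ < 1 → ∃ (s : ℕ) (δ : ℝ) (k : ℕ),
        ∀ (M : ℝ) (hM : 0 < M), ∃ ε > (0 : ℝ), ∃ C : ℝ, ∀ a : ℝ, |a| ≤ a₁ * M →
          Capture s δ k M hM ε C a :=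
  Iff.rfl

/-- `Capture` is antitone in the basin radius `ε` and monotone in the modulus constant `C`. -/
theorem Capture.mono [Kerr.Facts] [Kerr.SliceFacts] {s : ℕ} {δ : ℝ} {k : ℕ} {M : ℝ} {hM : 0 < M}
    {ε ε' C C' a : ℝ} (h : Capture s δ k M hM ε C a) (hε : ε' ≤ ε) (hC : C ≤ C') :
    Capture s δ k M hM ε' C' a := by
  intro D _ hvac hdist 𝒟 hmax
  obtain ⟨M', a', 𝒟oc, hsub, hfar, hconv, hmod⟩ :=
    h D hvac (hdist.trans_le (ENNReal.ofReal_le_ofReal hε)) 𝒟 hmax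
  exact ⟨M', a', 𝒟oc, hsub, hfar, hconv,
    hmod.trans (mul_le_mul_of_nonneg_right hC (Real.sqrt_nonneg _))⟩

/-- The same conclusion with a LIPSCHITZ modulus `C · dist` (what a Nash–Moser output bound or the secant
argument delivers; stronger than the crux's `C · √dist` on balls of radius `≤ 1`). -/
def CaptureLip [Kerr.Facts] [Kerr.SliceFacts] (s : ℕ) (δ : ℝ) (k : ℕ) (M : ℝ) (hM : 0 < M) (ε C a : ℝ) :
    Prop :=
  ∀ (D : InitialDataSet 𝓘(ℝ, E3) (Kerr.slice a M)) [D.metric.HasLeviCivita],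
    D.IsVacuumConstraintSolution →
    InitialDataSet.dataWeightedSobolevEDist s δ D (Kerr.data M a M hM.le) < ENNReal.ofReal ε →
    ∀ 𝒟 : VacuumCauchyDevelopment D, 𝒟.IsMaximal →
      ∃ (M' a' : ℝ) (𝒟oc : Set 𝒟.carrier), Kerr.IsSubextremal M' a' ∧
        (∀ [𝒟.metric.HasLeviCivita], ∃ B₀ : Set (Kerr.slice a M), IsCompact B₀ ∧ ∀ σ : ℝ, 0 < σ →
          ∃ B₁ : Set (Kerr.slice a M), IsCompact B₁ ∧
            ∀ q ∈ {q : Kerr.slice a M | Kerr.afRadius a M + 1 ≤ ‖(q : E3)‖}, q ∉ B₁ →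
              ∀ (ray : ℝ → 𝒟.carrier) (dom : Set ℝ),
                𝒟.metric.IsNormalisedNullRayFrom 𝒟.timeOrientation 𝒟.embed 𝒟.normal q ray dom →
                ¬ BddAbove dom ∨ ENNReal.ofReal σ ≤
                  sojournTime ray dom (𝒟.metric.causalFuture 𝒟.timeOrientation (𝒟.embed '' B₀))) ∧
        𝒟.toSpacetime.ConvergesToKerr 𝒟oc M' a' k ∧
        |M' - M| + |a' - a| ≤
          C * (InitialDataSet.dataWeightedSobolevEDist s δ D (Kerr.data M a M hM.le)).toReal

/-- Lipschitz modulus on a ball of radius `ε ≤ 1` implies the crux's `√`-modulus (for `0 ≤ C`), because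
`d ≤ √d` on `[0, 1]` — the crux's `√` is SLACK that every line below may cash. -/
theorem Capture.of_lip [Kerr.Facts] [Kerr.SliceFacts] {s : ℕ} {δ : ℝ} {k : ℕ} {M : ℝ} {hM : 0 < M}
    {ε C a : ℝ} (h : CaptureLip s δ k M hM ε C a) (hε : ε ≤ 1) (hC : 0 ≤ C) :
    Capture s δ k M hM ε C a := by
  intro D _ hvac hdist 𝒟 hmax
  obtain ⟨M', a', 𝒟oc, hsub, hfar, hconv, hmod⟩ := h D hvac hdist 𝒟 hmax
  refine ⟨M', a', 𝒟oc, hsub, hfar, hconv, hmod.trans (mul_le_mul_of_nonneg_left ?_ hC)⟩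
  set d := (InitialDataSet.dataWeightedSobolevEDist s δ D (Kerr.data M a M hM.le)).toReal with hd
  have hd0 : 0 ≤ d := ENNReal.toReal_nonneg
  have hd1 : d ≤ 1 := by
    have : d < ε := (ENNReal.lt_ofReal_iff_toReal_lt hdist.ne_top).1 hdist
    linarith
  exact (Real.le_sqrt hd0 hd0).2 (by nlinarith)

/-! ### Card 1 — local uniformity in the spin ratio gives the crux by compactness of `[−a₁, a₁]` -/

/-- **Locally uniform capture** (the transfer target `C⁺` of card 1): for every `a₁ < 1` there are exponents
`(s, δ, k)` such that every spin RATIO `α₀ ∈ [−a₁, a₁]` has a ratio-neighbourhood `|a/M − α₀| < η` on which,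
for every mass `M`, ONE pair `(ε, C)` works. This is the shape of a perturbative theorem read at one centre
(Hintz arXiv:2606.28253, Thm 13.1 with Remark 13.2: "Theorem 13.1 remains valid if … we replace `b₀` with
parameters `b₁` satisfying `|b₁ − b₀| < ε`"), made scale-covariant by phrasing the neighbourhood in `a/M`. -/
def LocallyUniformCapture : Prop :=
  ∀ [Kerr.Facts] [Kerr.SliceFacts], ∀ a₁ : ℝ, a₁ < 1 → ∃ (s : ℕ) (δ : ℝ) (k : ℕ),
    ∀ α₀ ∈ Set.Icc (-a₁) a₁, ∃ η > (0 : ℝ), ∀ (M : ℝ) (hM : 0 < M), ∃ ε > (0 : ℝ), ∃ C : ℝ,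
      ∀ a : ℝ, |a - α₀ * M| < η * M → Capture s δ k M hM ε C a

/-- **Card 1, first lemma.** Local uniformity in the spin ratio implies `BulkKerrCapture`: cover the compact
ratio interval `[−a₁, a₁]` by finitely many ratio-balls, take `ε := min`, `C := ∑ |Cᵢ|`. -/
theorem bulk_of_locallyUniform (h : LocallyUniformCapture) : BulkKerrCapture := by
  intro hF hS a₁ ha₁
  obtain ⟨s, δ, k, H⟩ := h a₁ ha₁
  refine ⟨s, δ, k, fun M hM ↦ ?_⟩
  by_cases ha₀ : a₁ < 0
  · -- empty spin range
    refine ⟨1, one_pos, 0, fun a ha ↦ ?_⟩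
    exfalso
    have : a₁ * M < 0 := mul_neg_of_neg_of_pos ha₀ hM
    linarith [abs_nonneg a]
  push Not at ha₀
  set K : Set ℝ := Set.Icc (-a₁) a₁ with hK
  have hKc : IsCompact K := isCompact_Icc
  -- choice of the ratio radius at each centre of K
  classical
  let η : K → ℝ := fun x ↦ (H x.1 x.2).choose
  have hηpos : ∀ x : K, 0 < η x := fun x ↦ (H x.1 x.2).choose_spec.1
  have hηspec : ∀ x : K, ∀ (M : ℝ) (hM : 0 < M), ∃ ε > (0 : ℝ), ∃ C : ℝ,
      ∀ a : ℝ, |a - x.1 * M| < η x * M → Capture s δ k M hM ε C a :=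
    fun x ↦ (H x.1 x.2).choose_spec.2
  -- finite subcover of K by the ratio balls
  have hcover : K ⊆ ⋃ x : K, Metric.ball (x : ℝ) (η x) := by
    intro y hy
    exact Set.mem_iUnion.2 ⟨⟨y, hy⟩, Metric.mem_ball_self (hηpos ⟨y, hy⟩)⟩
  obtain ⟨T, hT⟩ := hKc.elim_finite_subcover (fun x : K ↦ Metric.ball (x : ℝ) (η x))
    (fun _ ↦ Metric.isOpen_ball) hcover
  have hKne : (0 : ℝ) ∈ K := ⟨by linarith, ha₀⟩
  have hTne : T.Nonempty := by
    obtain ⟨x, hx⟩ := Set.mem_iUnion.1 (hT hKne)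
    obtain ⟨hxT, -⟩ := Set.mem_iUnion.1 hx
    exact ⟨x, hxT⟩
  -- constants at each centre of the subcover, for this M
  let εx : K → ℝ := fun x ↦ (hηspec x M hM).choose
  have hεxpos : ∀ x : K, 0 < εx x := fun x ↦ (hηspec x M hM).choose_spec.1
  let Cx : K → ℝ := fun x ↦ (hηspec x M hM).choose_spec.2.choose
  have hCx : ∀ x : K, ∀ a : ℝ, |a - x.1 * M| < η x * M → Capture s δ k M hM (εx x) (Cx x) a :=
    fun x ↦ (hηspec x M hM).choose_spec.2.choose_spec
  refine ⟨T.inf' hTne εx, (Finset.lt_inf'_iff hTne).2 (fun x _ ↦ hεxpos x), ∑ x ∈ T, |Cx x|,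
    fun a ha ↦ ?_⟩
  -- locate the ratio a/M in a ball of the subcover
  have haK : a / M ∈ K := by
    constructor
    · have h1 : -(a₁ * M) ≤ a := by linarith [neg_abs_le a, ha]
      rw [le_div_iff₀ hM]; linarith
    · rw [div_le_iff₀ hM]; linarith [le_abs_self a, ha]
  obtain ⟨x, hx⟩ := Set.mem_iUnion.1 (hT haK)
  obtain ⟨hxT, hax⟩ := Set.mem_iUnion.1 hx
  have hball : |a - x.1 * M| < η x * M := by
    rw [Metric.mem_ball, Real.dist_eq] at hax
    have hmul := mul_lt_mul_of_pos_right hax hM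
    have habs : |a - x.1 * M| = |a / M - x.1| * M := by
      rw [← abs_of_pos hM, ← abs_mul, abs_of_pos hM]
      congr 1
      field_simp
    rw [habs]
    exact hmul
  refine (hCx x a hball).mono (Finset.inf'_le εx hxT) ?_
  exact (le_abs_self _).trans
    (Finset.single_le_sum (f := fun y ↦ |Cx y|) (fun y _ ↦ abs_nonneg _) hxT)

/-! ### Card 2 — the secant (averaged-linearisation) modulus -/

/-- **Card 2, first lemma (secant modulus).** `Φ` is the data-to-defect map of the gauge-fixed Einstein system
composed with the Nash–Moser parametrisation (Hintz's `P ∘ Ψ`, arXiv:2606.28253 (13.6)), so that `Φ 0` is the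
defect of the glued background (size ≲ dist(data, Kerr data)) and the solution `U = (b − b₀, S, …)` has
`Φ U = 0`. If the reference linearisation `A` obeys the linear-stability / left-inverse estimate
`c‖v‖ ≤ ‖A v‖` (uniformly on compact spin sets: the LIN input) and `Φ` is `q`-approximately linear on the
basin `s` with `q < c` (it is `C²`: Nash–Moser hypothesis (1), p. 321), then the final-parameter modulus is
LIPSCHITZ with constant `(c − q)⁻¹`: `‖U‖ ≤ (c − q)⁻¹ ‖Φ 0‖`. Pure normed-space algebra. -/
theorem secant_modulus {E F : Type*} [NormedAddCommGroup E] [NormedSpace ℝ E] [NormedAddCommGroup F]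
    [NormedSpace ℝ F] (Φ : E → F) (A : E →L[ℝ] F) {c q : ℝ} (hqc : q < c)
    (hA : ∀ v : E, c * ‖v‖ ≤ ‖A v‖) (s : Set E)
    (hΦ : ∀ x ∈ s, ∀ y ∈ s, ‖Φ x - Φ y - A (x - y)‖ ≤ q * ‖x - y‖)
    {U : E} (hU : U ∈ s) (h0 : (0 : E) ∈ s) (hsol : Φ U = 0) :
    ‖U‖ ≤ (c - q)⁻¹ * ‖Φ 0‖ := by
  have hcq : 0 < c - q := sub_pos.2 hqc
  have h1 : c * ‖U‖ ≤ ‖A U‖ := hA U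
  have h2 : ‖Φ U - Φ 0 - A (U - 0)‖ ≤ q * ‖U - 0‖ := hΦ U hU 0 h0
  simp only [sub_zero, hsol, zero_sub] at h2
  have h3 : ‖A U‖ ≤ ‖Φ 0‖ + q * ‖U‖ := by
    calc ‖A U‖ = ‖-(A U)‖ := (norm_neg _).symm
      _ = ‖(-Φ 0 - A U) + Φ 0‖ := by congr 1; abel
      _ ≤ ‖-Φ 0 - A U‖ + ‖Φ 0‖ := norm_add_le _ _
      _ ≤ q * ‖U‖ + ‖Φ 0‖ := by linarith
      _ = ‖Φ 0‖ + q * ‖U‖ := by ring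
  have h4 : (c - q) * ‖U‖ ≤ ‖Φ 0‖ := by linarith
  calc ‖U‖ = (c - q)⁻¹ * ((c - q) * ‖U‖) := by field_simp
    _ ≤ (c - q)⁻¹ * ‖Φ 0‖ := mul_le_mul_of_nonneg_left h4 (inv_nonneg.2 hcq.le)

/-- **Card 2, companion lemma (all uniformity except the RATE is soft).** A POINTWISE modulus
`φ b r → 0` as `r ↓ 0` at each parameter `b` of a compact set `K`, monotone in `r`, together with the
RECENTRING inequality `φ b' r ≤ φ b (r + L|b' − b|) + |b' − b|` (valid near each `b`: data `r`-close to the Kerr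
data of spin `b'` are `(r + L|b' − b|)`-close to those of spin `b`, and final parameters within `φ b` of `b` are
within `φ b + |b' − b|` of `b'`), is automatically UNIFORM on `K`: `∀ η > 0, ∃ r > 0, ∀ b ∈ K, φ b r ≤ η`.
Finite-subcover proof (Dini-type). What it cannot give is a rate `φ b r ≤ C √r` with uniform `C`. -/
theorem uniform_qualitative_modulus {K : Set ℝ} (hK : IsCompact K) (φ : ℝ → ℝ → ℝ) {L : ℝ} (hL : 0 ≤ L)
    (hmono : ∀ b, Monotone (φ b))
    (hlim : ∀ b ∈ K, ∀ η > (0 : ℝ), ∃ t > (0 : ℝ), ∀ r, 0 < r → r < t → φ b r < η)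
    (hrec : ∀ b ∈ K, ∃ ρ > (0 : ℝ), ∀ b' ∈ K, |b' - b| < ρ → ∀ r, 0 < r →
      φ b' r ≤ φ b (r + L * |b' - b|) + |b' - b|) :
    ∀ η > (0 : ℝ), ∃ r > (0 : ℝ), ∀ b ∈ K, φ b r ≤ η := by
  intro η hη
  classical
  -- at each centre b ∈ K: a parameter radius θ b and a data radius t b / 2 that work on the whole ball
  have key : ∀ b : K, ∃ θ > (0 : ℝ), ∃ t > (0 : ℝ), ∀ b' ∈ K, |b' - b.1| < θ → φ b' (t / 2) ≤ η := by
    intro b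
    obtain ⟨t, ht, hφ⟩ := hlim b.1 b.2 (η / 2) (by linarith)
    obtain ⟨ρ, hρ, hR⟩ := hrec b.1 b.2
    refine ⟨min ρ (min (η / 2) (t / (2 * (L + 1)))), ?_, t, ht, fun b' hb' hθ ↦ ?_⟩
    · refine lt_min hρ (lt_min (by linarith) ?_)
      exact div_pos ht (by linarith)
    have hθρ : |b' - b.1| < ρ := hθ.trans_le (min_le_left _ _)
    have hθη : |b' - b.1| < η / 2 := hθ.trans_le ((min_le_right _ _).trans (min_le_left _ _))
    have hθt : |b' - b.1| < t / (2 * (L + 1)) :=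
      hθ.trans_le ((min_le_right _ _).trans (min_le_right _ _))
    have h1 := hR b' hb' hθρ (t / 2) (by linarith)
    have hpos : 0 < t / 2 + L * |b' - b.1| := by
      have : 0 ≤ L * |b' - b.1| := mul_nonneg hL (abs_nonneg _)
      linarith
    have hlt : t / 2 + L * |b' - b.1| < t := by
      have hL1 : 0 < L + 1 := by linarith
      have : L * |b' - b.1| ≤ L * (t / (2 * (L + 1))) := mul_le_mul_of_nonneg_left hθt.le hL
      have h2 : L * (t / (2 * (L + 1))) < t / 2 := by
        rw [mul_div_assoc']
        rw [div_lt_div_iff₀ (by positivity) (by norm_num)]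
        nlinarith
      linarith
    have h3 := hφ _ hpos hlt
    linarith
  choose θ hθpos t htpos hball using key
  have hcover : K ⊆ ⋃ b : K, Metric.ball (b : ℝ) (θ b) := fun y hy ↦
    Set.mem_iUnion.2 ⟨⟨y, hy⟩, Metric.mem_ball_self (hθpos ⟨y, hy⟩)⟩
  obtain ⟨T, hT⟩ := hK.elim_finite_subcover (fun b : K ↦ Metric.ball (b : ℝ) (θ b))
    (fun _ ↦ Metric.isOpen_ball) hcover
  by_cases hKe : K = ∅
  · exact ⟨1, one_pos, fun b hb ↦ by simp [hKe] at hb⟩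
  obtain ⟨y₀, hy₀⟩ := Set.nonempty_iff_ne_empty.2 hKe
  have hTne : T.Nonempty := by
    obtain ⟨x, hx⟩ := Set.mem_iUnion.1 (hT hy₀)
    obtain ⟨hxT, -⟩ := Set.mem_iUnion.1 hx
    exact ⟨x, hxT⟩
  refine ⟨T.inf' hTne (fun b ↦ t b / 2), (Finset.lt_inf'_iff hTne).2 (fun b _ ↦ by linarith [htpos b]),
    fun b' hb' ↦ ?_⟩
  obtain ⟨x, hx⟩ := Set.mem_iUnion.1 (hT hb')
  obtain ⟨hxT, hbx⟩ := Set.mem_iUnion.1 hx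
  rw [Metric.mem_ball, Real.dist_eq] at hbx
  exact (hmono b' (Finset.inf'_le (fun b ↦ t b / 2) hxT)).trans (hball x b' hb' hbx)

/-! ### Card 3 — in the charge superselection sector the modulus is a flux bound -/

/-- **Card 3, first lemma (charge balance ⇒ modulus).** If the final mass is the initial (= ADM, in the
superselection sector `δ > 1/2`) mass minus the radiated energy `E ∈ [0, M/2]`, and the final angular momentum
`a_f M_f` is the initial `a M` minus the radiated angular momentum `J`, then the crux's parameter modulus is
controlled by the FLUXES alone: `|M_f − M| + |a_f − a| ≤ E + 2(|a| E + |J|)/M`. With quadratic fluxes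
`E, |J| ≤ κ · dist²` this is `≲ dist²`, far inside the crux's `C √dist`. Pure algebra. -/
theorem modulus_of_charge_balance {M M_f a a_f E J : ℝ} (hM : 0 < M) (hE : 0 ≤ E) (hEM : E ≤ M / 2)
    (hMf : M_f = M - E) (hJ : a_f * M_f = a * M - J) :
    |M_f - M| + |a_f - a| ≤ E + 2 * (|a| * E + |J|) / M := by
  have hMfpos : 0 < M_f := by rw [hMf]; linarith
  have hMfge : M / 2 ≤ M_f := by rw [hMf]; linarith
  have h1 : |M_f - M| = E := by
    rw [hMf, show M - E - M = -E by ring, abs_neg, abs_of_nonneg hE]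
  have key : (a_f - a) * M_f = a * E - J := by
    rw [sub_mul, hJ, hMf]; ring
  have h2 : |a_f - a| * M_f ≤ |a| * E + |J| := by
    rw [← abs_of_pos hMfpos, ← abs_mul, key]
    calc |a * E - J| ≤ |a * E| + |J| := abs_sub _ _
      _ = |a| * E + |J| := by rw [abs_mul, abs_of_nonneg hE]
  have h3 : |a_f - a| ≤ 2 * (|a| * E + |J|) / M := by
    rw [le_div_iff₀ hM]
    have : |a_f - a| * M ≤ |a_f - a| * (2 * M_f) :=
      mul_le_mul_of_nonneg_left (by linarith) (abs_nonneg _)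
    nlinarith [abs_nonneg (a_f - a)]
  linarith

/-- Corollary used by the card: quadratic fluxes `E, |J| ≤ κ d²` on a ball `d ≤ 1` (and `κ ≤ M/2`) give a
LIPSCHITZ — indeed quadratic — modulus `≤ κ (1 + 2(|a| + 1)/M) · d²` (for `0 ≤ κ ≤ M/2`). -/
theorem modulus_of_quadratic_flux {M M_f a a_f E J κ d : ℝ} (hM : 0 < M) (hE : 0 ≤ E) (hd0 : 0 ≤ d)
    (hd : d ≤ 1) (hκ0 : 0 ≤ κ) (hκ : κ ≤ M / 2) (hEκ : E ≤ κ * d ^ 2) (hJκ : |J| ≤ κ * d ^ 2)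
    (hMf : M_f = M - E) (hJ : a_f * M_f = a * M - J) :
    |M_f - M| + |a_f - a| ≤ κ * (1 + 2 * (|a| + 1) / M) * d ^ 2 := by
  have hd2 : d ^ 2 ≤ 1 := by nlinarith
  have hEM : E ≤ M / 2 := hEκ.trans ((mul_le_of_le_one_right hκ0 hd2).trans hκ)
  have h := modulus_of_charge_balance hM hE hEM hMf hJ
  have h4 : |a| * E + |J| ≤ (|a| + 1) * (κ * d ^ 2) := by
    have : |a| * E ≤ |a| * (κ * d ^ 2) := mul_le_mul_of_nonneg_left hEκ (abs_nonneg a)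
    linarith
  have h5 : 2 * (|a| * E + |J|) / M ≤ 2 * ((|a| + 1) * (κ * d ^ 2)) / M := by
    gcongr
  calc |M_f - M| + |a_f - a| ≤ E + 2 * (|a| * E + |J|) / M := h
    _ ≤ κ * d ^ 2 + 2 * ((|a| + 1) * (κ * d ^ 2)) / M := by linarith
    _ = κ * (1 + 2 * (|a| + 1) / M) * d ^ 2 := by ring

/-! ### Recentring infrastructure: a far region common to all slices of the compact spin range -/

/-- Every horizon-penetrating slice `Kerr.slice a M` with `|a| ≤ a₁ M` contains the fixed far region
`{‖y‖ > M √(1 + a₁²) + 1}`; on it, data of different spins can be compared by restriction (no diffeomorphism),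
which is where the spin difference of Kerr data is the explicit `O(|a − a'|) r⁻²` polyhomogeneous seed
(Hintz arXiv:2606.28253, Remark 13.2 and (3.21)). -/
theorem far_subset_slice {a₁ M a : ℝ} (hM : 0 < M) (ha : |a| ≤ a₁ * M) {y : E3}
    (hy : M * √(1 + a₁ ^ 2) + 1 < ‖y‖) : y ∈ Kerr.slice a M := by
  apply Kerr.mem_slice_of_lt_norm
  refine lt_of_le_of_lt ?_ hy
  unfold Kerr.afRadius
  have hmax : max M 0 = M := max_eq_left hM.le
  rw [hmax]
  gcongr
  · calc √(M ^ 2 + a ^ 2) ≤ √(M ^ 2 + (a₁ * M) ^ 2) := by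
          apply Real.sqrt_le_sqrt
          have : a ^ 2 ≤ (a₁ * M) ^ 2 := by
            rw [← sq_abs a]
            exact pow_le_pow_left₀ (abs_nonneg a) ha 2
          linarith
      _ = M * √(1 + a₁ ^ 2) := by
          rw [show M ^ 2 + (a₁ * M) ^ 2 = M ^ 2 * (1 + a₁ ^ 2) by ring, Real.sqrt_mul (sq_nonneg M),
            Real.sqrt_sq hM.le]

end Summit.FinalStateConjecture.FinalStateConjecture.Cruxes.BulkKerrCapture.SketchIdeator2
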